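import Summits.QuantumFields.QCD.Theses.NestedDissectionSea

/-!
# `DiluteOfEarlyCrossers` — the early-crosser law implies the tier-deciding dilution crux

Route `NestedDissectionSea` (sub-problem QCD), support item stmt-QuantumFields-13979.

`EarlyCrosserLaw` (stmt-QuantumFields-13995) shares its `∃ reg … ∃ R` prefix with
`NegativeCellsDilute` (stmt-QuantumFields-13900). Its clause (a′) bounds, for every window box at
dyadic scale `j`, the phase-quenched probability of EVERY event `E` that implies "for some flavour `f`
and some bare mass `μ′ ≥ m_f(k)` the box or one of its sixteen children has a singular Dirichlet
Wilson cell" by `δ j`, with `Σ_{j<J} δ j ≤ ε`; `SignDefectForcesCrossing` (stmt-QuantumFields-13898)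
says that a sign defect `IsSignDefect U (m_f k) j s` is such an event. Instantiating
`E := fun U => ∃ f, IsSignDefect U (m_f k) j s` gives clause (a) of `NegativeCellsDilute`; clause (b)
(the parity pin below the line) is clause (b) of `EarlyCrosserLaw` verbatim, and the upper companion
(b″) is dropped. Pure logic: unpack, instantiate, repack.
-/

namespace Summit.QuantumFields.QCD.Theses.NestedDissectionSea
/-- **Record of the dropped route item `DiluteOfEarlyCrossers`** = stmt-QuantumFields-13979 (ledger signature verbatim; NOT a route
item): route NestedDissectionSea (2026-08-17T00:56Z) dropped the proved item `DiluteOfEarlyCrossers`. The declaration `Summit.QuantumFields.QCD.Theses.NestedDissectionSea.DiluteOfEarlyCrossers`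
therefore no longer exists in the route file and this accepted module stopped elaborating (stale olean;
buildfix lane 2026-08-19). Re-created here under its original name so the result keeps building; the
statement of every previously accepted declaration in this file is unchanged. -/
def DiluteOfEarlyCrossers : Prop :=
  EarlyCrosserLaw → SignDefectForcesCrossing → NegativeCellsDilute
end Summit.QuantumFields.QCD.Theses.NestedDissectionSea


namespace Summit.QuantumFields.QCD.Theorems

open Summit.QuantumFields.QCD.Theses.NestedDissectionSea
open Literature.MathematicalPhysics.QuantumLattice Literature.MathematicalPhysics.QuantumFieldTheory
  Literature.Probability.LatticeModels

/-- **DiluteOfEarlyCrossers** (route `NestedDissectionSea`, item stmt-QuantumFields-13979):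
`EarlyCrosserLaw → SignDefectForcesCrossing → NegativeCellsDilute`. The early-crosser law bounds the
phase-quenched probability of any event contained in "parent or a child cell is singular at some
`μ′ ≥ m_f(k)`"; `SignDefectForcesCrossing` puts the sign-defect event inside it; the parity pin is
shared verbatim. -/
theorem diluteOfEarlyCrossers_proof :
    Summit.QuantumFields.QCD.Theses.NestedDissectionSea.DiluteOfEarlyCrossers := by
  unfold DiluteOfEarlyCrossers
  intro hLaw hCross Nf hNf
  obtain ⟨reg, hms, has, M₀, hM₀, b₀, hb₀, ℓ, hℓ, hbody⟩ := hLaw Nf hNf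
  refine ⟨reg, hms, has, M₀, hM₀, b₀, hb₀, ℓ, hℓ, fun m hm => ?_⟩
  obtain ⟨R, hR, ha, hb, -⟩ := hbody m hm
  refine ⟨R, hR, fun ε hε => ?_, hb⟩
  filter_upwards [ha ε hε] with k hk S hS
  obtain ⟨δ, -, hsum, hbox⟩ := hk S hS
  refine ⟨δ, hsum, fun j hj s hs => ?_⟩
  have key : ∀ U : GaugeConfig 4 (2 * S + 1) (Matrix.specialUnitaryGroup (Fin 3) ℂ),
      (∃ f : Fin Nf, IsSignDefect U (reg.mcrit k + reg.a k * m f / reg.Zm k) j s) →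
        ∃ f : Fin Nf, ∃ μ' : ℝ, reg.mcrit k + reg.a k * m f / reg.Zm k ≤ μ' ∧
          ((wilsonCell U μ' 0 s).det = 0 ∨
            ∃ c : Fin 4 → Bool, (wilsonCell U μ' (halfCorner s c) (halfSides s c)).det = 0) := by
    rintro U ⟨f, hdef⟩
    obtain ⟨μ', hμ', h⟩ := hCross (2 * S + 1) U _ j s hdef
    exact ⟨f, μ', hμ', h⟩
  exact hbox j hj s hs _ key

end Summit.QuantumFields.QCD.Theorems
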